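import Mathlib
import Summits.ValiantsHypothesis.ValiantsHypothesis.Theses.BarrierLever
import Summits.ValiantsHypothesis.ValiantsHypothesis.Theorems.BarrierLeverDefinableEquationsDefs
import Summits.ValiantsHypothesis.ValiantsHypothesis.Theorems.BarrierLeverDefinableEquationsStubRazTopUniversality
import Summits.ValiantsHypothesis.ValiantsHypothesis.Theorems.BarrierLeverDefinableEquationsStubSignGadget
import Summits.ValiantsHypothesis.ValiantsHypothesis.Theorems.BarrierLeverDefinableEquationsStubWeightGadget
import Summits.ValiantsHypothesis.ValiantsHypothesis.Theorems.BarrierLeverDefinableEquationsStubSelGadget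
import Summits.ValiantsHypothesis.ValiantsHypothesis.Theorems.BarrierLeverDefinableEquationsStubDatumWitness
import Summits.ValiantsHypothesis.ValiantsHypothesis.Theorems.BarrierLeverDefinableEquationsStubCombClosure

/-!
# Crux `BarrierLever.DefinableEquations` (stmt-ValiantsHypothesis-8745), line `registered` — the
# reduction: the crux follows from the short tableau equation ALONE

With the six landed stubs of the line (Raz top-component universality `stub_razTopUniversality`;
the Valiant-criterion gadgets `stub_signGadget`, `stub_weightGadget`, `stub_selGadget`; the per-datum
witness `stub_datumWitness`; the linear closure `stub_combClosure`) every part of the skeleton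
except its heart is discharged.  This file records the two sorry-free consequences:

* `tableauSumsDefinable` — **Valiant's criterion at scale `N = C(2n,n)` for short tableau
  combinations**, unconditionally: for `n ≥ 2`, every combination of `k ≤ N` tableau contractions
  with `N`-bounded data, renamed into the crux's `degLEMonomials n` variables, is `boolSum H` with
  `q, L(H), deg H ≤ N ^ 35` (level `a = 35`, independent of everything);
* `DefinableEquations_of_shortTableauEquation` — **the crux reduces to the short tableau equation**
  (registered stub `stub_shortTableauEquation`, OPEN): if for every size exponent `b`, eventually in
  `n`, some nonzero short combination vanishes on the image of Raz's map `Γ` on the top monomials,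
  then `BarrierLever.DefinableEquations` holds (with `a = 35`);
* `tableauSumsDefinable_pow`, `DefinableEquations_of_polyShortTableauEquation` — the same with the
  shortness scale `N` relaxed to `N ^ c` for any constant `c ≥ 1` (level `a = 17c + 18`): H should be
  read as "a POLYNOMIALLY short symbolic equation", matching the crux's own slack `N ^ a`.

So the crux is CLOSED MODULO the single statement H about the vanishing ideal of the image of
one explicit polynomial map (Raz's `Γ`); no quantifier over circuits, boolean sums or coefficient
vectors remains in H.
-/

-- Sub = Summit single-conjunct layout: the duplicated namespace component is mandated by the tree.
set_option linter.dupNamespace false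

noncomputable section

namespace Summit.ValiantsHypothesis.ValiantsHypothesis.Theorems.BarrierLeverDefinableEquations

open MvPolynomial
open Literature.Computability.AlgebraicComplexity Literature.Barriers.ValiantsHypothesis
open scoped BigOperators

/-- `2 n ≤ C(2n, n)` (the middle binomial coefficient dominates `C(2n, 1)`). [folklore] -/
theorem two_mul_le_centralChoose (n : ℕ) : 2 * n ≤ Nat.choose (2 * n) n := by
  have h := Nat.choose_le_middle 1 (2 * n)
  rwa [Nat.choose_one_right, Nat.mul_div_cancel_left n Nat.two_pos] at h

/-- **Valiant's criterion at scale `N` for short tableau combinations** (the planner's stub V of the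
birth skeleton, now a theorem): level `a = 35`, threshold `n ≥ 2`.  From the five landed V-stubs:
per-datum witnesses (`stub_datumWitness` fed with the three gadgets) combined by `stub_combClosure`
at `B = N`, then `N + n + 2 ≤ 2N` and `2 ≤ N` (`two_mul_le_centralChoose`). [folklore] -/
theorem tableauSumsDefinable :
    ∀ n ≥ 2, ∀ (k : ℕ) (τ : Fin k → TabDatum n) (c : Fin k → ℂ),
      ShortComb (Nat.choose (2 * n) n) τ →
        ∃ q : ℕ, q ≤ (Nat.choose (2 * n) n) ^ 35 ∧
          ∃ H : MvPolynomial (↥(degLEMonomials n) ⊕ Fin q) ℂ,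
            complexity H ≤ (Nat.choose (2 * n) n) ^ 35 ∧ H.totalDegree ≤ (Nat.choose (2 * n) n) ^ 35 ∧
              boolSum H = rename (topIncl n) (combPoly τ c) := by
  intro n hn k τ c hshort
  set N := Nat.choose (2 * n) n with hNdef
  obtain ⟨hk, hB⟩ := hshort
  have hn1 : 1 ≤ n := by omega
  have hdat : ∀ i, datumWitnessSpec n (τ i) N := fun i =>
    stub_datumWitness n (τ i) N hn1 (hB i) (stub_signGadget n (τ i) N (hB i))
      (stub_weightGadget n (τ i) N (hB i)) (stub_selGadget n (τ i) N hn1 (hB i))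
  obtain ⟨H, hsum, hcx, hdeg⟩ := stub_combClosure n k τ c N hk hB hdat
  have h2n : 2 * n ≤ N := two_mul_le_centralChoose n
  have hN2 : 2 ≤ N := by omega
  have hP : N + n + 2 ≤ 2 * N := by omega
  have hpow : ∀ m : ℕ, (N + n + 2) ^ m ≤ 2 ^ m * N ^ m := fun m => by
    rw [← mul_pow]; exact Nat.pow_le_pow_left hP m
  have h2le : ∀ m : ℕ, 2 ^ m ≤ N ^ m := fun m => Nat.pow_le_pow_left hN2 m
  refine ⟨N * n * n, ?_, H, ?_, ?_, hsum⟩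
  · calc N * n * n ≤ N * N * N := by gcongr <;> omega
      _ = N ^ 3 := by ring
      _ ≤ N ^ 35 := Nat.pow_le_pow_right (by omega) (by norm_num)
  · calc complexity H ≤ (N + n + 2) ^ 17 * N := hcx
      _ ≤ 2 ^ 17 * N ^ 17 * N := Nat.mul_le_mul_right _ (hpow 17)
      _ ≤ N ^ 17 * N ^ 17 * N := Nat.mul_le_mul_right _ (Nat.mul_le_mul_right _ (h2le 17))
      _ = N ^ 35 := by ring
  · calc H.totalDegree ≤ (N + n + 2) ^ 7 := hdeg
      _ ≤ 2 ^ 7 * N ^ 7 := hpow 7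
      _ ≤ N ^ 7 * N ^ 7 := Nat.mul_le_mul_right _ (h2le 7)
      _ = N ^ 14 := by ring
      _ ≤ N ^ 35 := Nat.pow_le_pow_right (by omega) (by norm_num)

/-- **The crux reduces to the short tableau equation** (registered stub `stub_shortTableauEquation`
of the line, OPEN — the hypothesis, spelled out): for every size exponent `b`, eventually in `n`,
some complex combination of `k ≤ N` tableau contractions with `N`-bounded data (`N = C(2n,n)`) is
a nonzero polynomial in the top coefficient variables vanishing on the image of Raz's map `Γ`
(slots `4 n^b (n+1)²`).  Conclusion: `BarrierLever.DefinableEquations` with level `a = 35`: Raz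
universality (`stub_razTopUniversality`) puts `coeff(f)|_top` on the Raz image for every
`f ∈ SmallCircuits ℂ n b`, `tableauSumsDefinable` makes the renamed combination a level-35 boolean
sum, nonzero by injectivity of `rename (topIncl n)`. [folklore] -/
theorem DefinableEquations_of_shortTableauEquation :
    (∀ b : ℕ, ∃ n₀ : ℕ, ∀ n ≥ n₀, ∃ (k : ℕ) (τ : Fin k → TabDatum n) (a : Fin k → ℂ),
      ShortComb (Nat.choose (2 * n) n) τ ∧ combPoly τ a ≠ 0 ∧
        ∀ y : RazUniversal.Lab (Fin n) n (razSlots n b) → ℂ,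
          eval (razPoint n b y) (combPoly τ a) = 0) →
      Summit.ValiantsHypothesis.ValiantsHypothesis.Theses.BarrierLever.DefinableEquations := by
  intro hH
  refine ⟨35, fun b => ?_⟩
  obtain ⟨n₀, hH⟩ := hH b
  refine ⟨n₀ + 2, fun n hn => ?_⟩
  obtain ⟨k, τ, cf, hshort, hne, hvan⟩ := hH n (by omega)
  obtain ⟨q, hq, H, hHc, hHd, hsum⟩ := tableauSumsDefinable n (by omega) k τ cf hshort
  refine ⟨q, hq, H, hHc, hHd, ?_, ?_⟩
  · rw [hsum]
    intro h0
    apply hne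
    apply MvPolynomial.rename_injective _ (topIncl_injective n)
    rw [h0, map_zero]
  · intro f hf
    obtain ⟨y, hy⟩ := stub_razTopUniversality n b (by omega) f hf
    rw [hsum, MvPolynomial.eval_rename]
    have hpt : (coeffVector (degLEMonomials n) f ∘ topIncl n) = razPoint n b y := by
      funext e
      rw [Function.comp_apply, coeffVector_apply, hy e]
      rfl
    rw [hpt]
    exact hvan y

/-! ## Polynomial shortness

The shortness scale `N` in H is arbitrary up to a polynomial: data and counts bounded by `N ^ c` still
give ONE level `a = 17c + 18` (independent of `b`).  This is the form in which H should be read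
("a polynomially-short symbolic equation"), matching the crux's own polynomial slack `N ^ a`. -/

/-- **Valiant's criterion at scale `N^c`**: for `n ≥ 2`, `1 ≤ c`, every combination of `k ≤ N^c`
tableau contractions with `N^c`-bounded data is, after renaming into `degLEMonomials n`, a boolean
sum of level `17c + 18`. [folklore] -/
theorem tableauSumsDefinable_pow (c : ℕ) (hc : 1 ≤ c) :
    ∀ n ≥ 2, ∀ (k : ℕ) (τ : Fin k → TabDatum n) (cf : Fin k → ℂ),
      ShortComb ((Nat.choose (2 * n) n) ^ c) τ →
        ∃ q : ℕ, q ≤ (Nat.choose (2 * n) n) ^ (17 * c + 18) ∧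
          ∃ H : MvPolynomial (↥(degLEMonomials n) ⊕ Fin q) ℂ,
            complexity H ≤ (Nat.choose (2 * n) n) ^ (17 * c + 18) ∧
              H.totalDegree ≤ (Nat.choose (2 * n) n) ^ (17 * c + 18) ∧
                boolSum H = rename (topIncl n) (combPoly τ cf) := by
  intro n hn k τ cf hshort
  set N := Nat.choose (2 * n) n with hNdef
  set B := N ^ c with hBdef
  obtain ⟨hk, hB⟩ := hshort
  have hn1 : 1 ≤ n := by omega
  have hdat : ∀ i, datumWitnessSpec n (τ i) B := fun i =>
    stub_datumWitness n (τ i) B hn1 (hB i) (stub_signGadget n (τ i) B (hB i))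
      (stub_weightGadget n (τ i) B (hB i)) (stub_selGadget n (τ i) B hn1 (hB i))
  obtain ⟨H, hsum, hcx, hdeg⟩ := stub_combClosure n k τ cf B hk hB hdat
  have h2n : 2 * n ≤ N := two_mul_le_centralChoose n
  have hN2 : 2 ≤ N := by omega
  have hN1 : 1 ≤ N := by omega
  have hNB : N ≤ B := by
    calc N = N ^ 1 := (pow_one N).symm
      _ ≤ N ^ c := Nat.pow_le_pow_right hN1 hc
  have hP : B + n + 2 ≤ 2 * B := by omega
  have hpow : ∀ m : ℕ, (B + n + 2) ^ m ≤ 2 ^ m * B ^ m := fun m => by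
    rw [← mul_pow]; exact Nat.pow_le_pow_left hP m
  have h2le : ∀ m : ℕ, 2 ^ m ≤ N ^ m := fun m => Nat.pow_le_pow_left hN2 m
  have hBpow : ∀ m : ℕ, B ^ m = N ^ (c * m) := fun m => by rw [hBdef, ← pow_mul]
  refine ⟨B * n * n, ?_, H, ?_, ?_, hsum⟩
  · calc B * n * n ≤ B * N * N := by gcongr <;> omega
      _ = N ^ (c + 2) := by rw [hBdef]; ring
      _ ≤ N ^ (17 * c + 18) := Nat.pow_le_pow_right hN1 (by omega)
  · calc complexity H ≤ (B + n + 2) ^ 17 * N := hcx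
      _ ≤ 2 ^ 17 * B ^ 17 * N := Nat.mul_le_mul_right _ (hpow 17)
      _ ≤ N ^ 17 * B ^ 17 * N := Nat.mul_le_mul_right _ (Nat.mul_le_mul_right _ (h2le 17))
      _ = N ^ (17 * c + 18) := by
          rw [hBpow 17]; rw [← pow_add, ← pow_succ]; congr 1; ring
  · calc H.totalDegree ≤ (B + n + 2) ^ 7 := hdeg
      _ ≤ 2 ^ 7 * B ^ 7 := hpow 7
      _ ≤ N ^ 7 * B ^ 7 := Nat.mul_le_mul_right _ (h2le 7)
      _ = N ^ (7 * c + 7) := by rw [hBpow 7, ← pow_add]; congr 1; ring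
      _ ≤ N ^ (17 * c + 18) := Nat.pow_le_pow_right hN1 (by omega)

/-- **The crux from a POLYNOMIALLY short tableau equation**: if for some exponent `c ≥ 1` and every
size exponent `b`, eventually in `n`, a nonzero combination of `k ≤ N^c` tableau contractions with
`N^c`-bounded data vanishes on the image of Raz's map `Γ`, then `BarrierLever.DefinableEquations`
holds with level `a = 17c + 18`. [folklore] -/
theorem DefinableEquations_of_polyShortTableauEquation (c : ℕ) (hc : 1 ≤ c)
    (hH : ∀ b : ℕ, ∃ n₀ : ℕ, ∀ n ≥ n₀, ∃ (k : ℕ) (τ : Fin k → TabDatum n) (a : Fin k → ℂ),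
      ShortComb ((Nat.choose (2 * n) n) ^ c) τ ∧ combPoly τ a ≠ 0 ∧
        ∀ y : RazUniversal.Lab (Fin n) n (razSlots n b) → ℂ,
          eval (razPoint n b y) (combPoly τ a) = 0) :
    Summit.ValiantsHypothesis.ValiantsHypothesis.Theses.BarrierLever.DefinableEquations := by
  refine ⟨17 * c + 18, fun b => ?_⟩
  obtain ⟨n₀, hH⟩ := hH b
  refine ⟨n₀ + 2, fun n hn => ?_⟩
  obtain ⟨k, τ, cf, hshort, hne, hvan⟩ := hH n (by omega)
  obtain ⟨q, hq, H, hHc, hHd, hsum⟩ := tableauSumsDefinable_pow c hc n (by omega) k τ cf hshort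
  refine ⟨q, hq, H, hHc, hHd, ?_, ?_⟩
  · rw [hsum]
    intro h0
    apply hne
    apply MvPolynomial.rename_injective _ (topIncl_injective n)
    rw [h0, map_zero]
  · intro f hf
    obtain ⟨y, hy⟩ := stub_razTopUniversality n b (by omega) f hf
    rw [hsum, MvPolynomial.eval_rename]
    have hpt : (coeffVector (degLEMonomials n) f ∘ topIncl n) = razPoint n b y := by
      funext e
      rw [Function.comp_apply, coeffVector_apply, hy e]
      rfl
    rw [hpt]
    exact hvan y

end Summit.ValiantsHypothesis.ValiantsHypothesis.Theorems.BarrierLeverDefinableEquations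

end
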